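import Summits.BirchSwinnertonDyer.Rank1Residual.GaloisImage.KolyvaginLevelOneNineDividesOfBaseRigidity
import Summits.BirchSwinnertonDyer.Rank1Residual.GaloisImage.PropagatedConditionCardEP
import HarnessLib

/-!
# END-m1 [S24]-FREE with the binder `hEP` DISCHARGED by Tate's local Euler–Poincaré characteristic
# (cell `b2b-bsdres`, team n1011, ROUTE-1 §33.3 / §34.3 R1-57 / R1-58; row T-R1-57-A lineage; seat p09 GEN 8;
# lead R5-75 (b)(i) CONSUMER RULE: "`hEP` may now be discharged by `EPCTate.localEulerPoincareCharacteristic`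
# — by YOUR OWN append in YOUR file, one theorem per END, docstring 'hEP discharged by p300886'")

HONEST FRAMING (cell `b2b-bsdres`, run/shared/lean/b2b/bsd-rank1-residual/, verbatim in every
file): the goal of the cell is to DELETE the COMBINATION-SHAPED residual classes of the
Birch–Swinnerton-Dyer formula for ALL analytic-rank `≤ 1` elliptic curves over `ℚ` — "full BSD
formula for every rank `≤ 1` curve in class `C`" assembled STRICTLY from published theorems — so
that the rank-`≤ 1` remainder becomes exactly the CONSTRUCTION-SHAPED classes, which are TYPED
(missing-input `Prop`s), NOT attempted. This is not "finishing BSD". Team n1011 (N10/N11, the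
additive block X4 ∧ `p = 3`): research route; TOOL theorems only (no definition, no named fact, no
`sorry`); nothing booked; no mark / label moved. END-m1 is DEBT REDUCTION on the level-one rows,
NOT coverage: the PORT (DICT3₁ `KatoKuriharaDictionaryThreeOneAt W 0 D v₃`), the Poitou–Tate family at
`3` (`inv hperf hsum hcompl`) and every other listed input REMAIN HYPOTHESES; no class closes.

## What

This is the sibling of `KolyvaginLevelOneNineDividesOfBaseRigidity.lean` (n1011-p09 GEN 7, p291959) —
a NEW file rather than an append only because the 400-line cap leaves no room there — carrying, for
each of its three theorems with the binder
`(hEP : ∀ v, localEulerPoincareCharacteristic (v.adicCompletion ℚ))`, the twin with `hEP` DELETED and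
the slot fed `EP.forall_localEulerPoincareCharacteristic_adicCompletion ℚ` (n1011-p04 GEN 9,
`PropagatedConditionCardEP.lean`, over `EPCTate.localEulerPoincareCharacteristic` = Tate's local
Euler–Poincaré characteristic formula as a THEOREM of the tree, p300886 `EPCTateFormula.lean`):

* `kolyvaginSystem_eq_zero_of_apply_empty_eq_zero_of_baseRigidity_epc` — injectivity at the core
  vertex `∅` on `(E[3], 𝓕̄_can)` by base rigidity (the `hinj` discharger of END-m1 / END-m2);
* `exists_ne_zero_mem_selmerGroup_three_of_dictionaryOne_of_levelOne_certificate_of_baseRigidity_epc` —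
  END-m1 `Sel^{(3)}(E/ℚ) ∋ x ≠ 0`;
* `natCard_selmerGroup_three_ne_one_of_dictionaryOne_of_levelOne_certificate_of_baseRigidity_epc` —
  END-m1 `#Sel^{(3)}(E/ℚ) ≠ 1` (the record side's shape).

BINDER DIFF vs the parents = `{hEP}` EXACTLY (same order otherwise); proofs are one-term applications
of the parents; "hEP discharged by p300886".  Nothing else changes: the PORT, the Poitou–Tate family,
the parametrisation / Manin / period inputs, the certificate, Cassels–Tate downstream — all as before.

References: J. Tate (1963) / J. S. Milne, *Arithmetic Duality Theorems* (2006) I Thm. 2.8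
[MilneADT2006]; C.-H. Kim, AJM 148 (2026) Thm. 3.13 [Kim2022StructureSelmer]; K. Rubin, PCMI 18 (2011)
Thm. 2.8.4, Cor. 2.8.9 [Rubin2011]; R. Sakamoto, JTNB 36 (2024) Cor. 5.5 [Sakamoto2024].
-/

noncomputable section

open scoped Classical NumberField ContRepresentation
open Function Field NumberField IsDedekindDomain
open WeierstrassCurve Literature.NumberTheory.EllipticCurves Literature.NumberTheory.EllipticCurves.ModularForms
  Literature.NumberTheory.EllipticCurves.Rank1Residual
  Literature.NumberTheory.EllipticCurves.Rank1Residual.Typed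
  Literature.NumberTheory.GaloisRepresentations
  Literature.NumberTheory.GaloisRepresentations.DiscreteGaloisModule Literature.NumberTheory.GaloisCohomology
open Literature.NumberTheory.DiophantineGeometry.Dioph (ratModP)

namespace Summit.BirchSwinnertonDyer.Rank1Residual.GaloisImage

variable (W : WeierstrassCurve ℚ) [W.IsElliptic]

/-- **Injectivity at the core vertex `∅` on `(E[3], 𝓕̄_can)` by BASE RIGIDITY, `hEP`-FREE**:
`kolyvaginSystem_eq_zero_of_apply_empty_eq_zero_of_baseRigidity` with the binder `hEP` DELETED —
hEP discharged by p300886 (`EPCTate.localEulerPoincareCharacteristic`, via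
`EP.forall_localEulerPoincareCharacteristic_adicCompletion ℚ`).  Every other binder unchanged and in the
same order. [cite: Rubin2011, Prop. 2.3.2 (1) and Cor. 2.8.9 (2) (pp. 19, 25)]
[cite: Sakamoto2024, Cor. 5.5 (p. 929)] [cite: MilneADT2006, I §2 Thm 2.8 (p. 31)] -/
theorem kolyvaginSystem_eq_zero_of_apply_empty_eq_zero_of_baseRigidity_epc
    [Finite (geomTorsion W ((3 : ℕ) : ℤ))]
    (h3 : W.HasSurjectiveModNGaloisRep ((3 : ℕ) : ℤ))
    (τ : absoluteGaloisGroup ℚ) (hτμ : τ ∈ rootsOfUnityFixer ℚ 3)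
    (hτq : Nonempty (cokerSubOne (W.torsionGaloisModule ((3 : ℕ) : ℤ)) τ ≃+ ZMod 3))
    (inv : LocalInvariants ℚ 3) (hperf : inv.IsPerfect) (hsum : inv.SumLocalTermEqZero)
    (hcompl : inv.SelmerComplement)
    (S : Finset (Place ℚ)) (hS : ∀ w : InfinitePlace ℚ, (Sum.inl w : Place ℚ) ∈ S)
    (h3S : ∀ v : HeightOneSpectrum (𝓞 ℚ), ((3 : ℕ) : 𝓞 ℚ) ∈ v.asIdeal → (Sum.inr v : Place ℚ) ∈ S)
    (hbadS : ∀ v : HeightOneSpectrum (𝓞 ℚ), ¬ W.HasGoodReductionAt v → (Sum.inr v : Place ℚ) ∈ S)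
    (D : KolyvaginDatum (W.torsionGaloisModule ((3 : ℕ) : ℤ)))
    (η : (q : HeightOneSpectrum (𝓞 ℚ)) → (ZMod (Ideal.absNorm q.asIdeal))ˣ)
    (hP : D.primes = frobeniusClassPrimes (W.torsionGaloisModule ((3 : ℕ) : ℤ))
      {v | (Sum.inr v : Place ℚ) ∈ S} τ 3)
    (hT : D.transverse = cyclotomicTransverse (W.torsionGaloisModule ((3 : ℕ) : ℤ)))
    (hD : D.HasCanonicalComparison 3 η) :
    ∀ κ : Finset (HeightOneSpectrum (𝓞 ℚ)) → galoisCohomology (W.torsionGaloisModule ((3 : ℕ) : ℤ)) 1,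
      D.IsKolyvaginSystem (propagatedSelmerStructureOne W 3) κ →
      (inv.dualSelmerStructure (W.torsionGaloisModule ((3 : ℕ) : ℤ))
        (D.atLevel (propagatedSelmerStructureOne W 3) ∅)).selmerGroup = ⊥ →
      κ ∅ = 0 → ∀ m, κ m = 0 :=
  kolyvaginSystem_eq_zero_of_apply_empty_eq_zero_of_baseRigidity W h3 τ hτμ hτq inv hperf hsum hcompl
    (EP.forall_localEulerPoincareCharacteristic_adicCompletion ℚ) S hS h3S hbadS D η hP hT hD

/-- **END-m1 "nine divides Ш" in `3`-Selmer currency, [S24]-FREE and `hEP`-FREE**: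
`exists_ne_zero_mem_selmerGroup_three_of_dictionaryOne_of_levelOne_certificate_of_baseRigidity` with
the binder `hEP` DELETED — hEP discharged by p300886 (`EPCTate.localEulerPoincareCharacteristic`, via
`EP.forall_localEulerPoincareCharacteristic_adicCompletion ℚ`).  Every other binder (surj(3), `τ`, the
Poitou–Tate family at `3`, admissible `S`, the datum `D` on Sakamoto's primes with cyclotomic transverse
conditions and canonical comparison maps, the PORT `KatoKuriharaDictionaryThreeOneAt W 0 D v₃`, the
row and parametrisation data, `3 ∣ [0]⁺`, the level `n` and its UNIT certificate) unchanged and in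
the same order; they remain HYPOTHESES.  Debt reduction, not coverage; nothing booked.
[cite: Kim2022StructureSelmer, Thm. 3.13] [cite: Rubin2011, Thm. 2.8.4 and Cor. 2.8.9 (pp. 25–26)]
[cite: Sakamoto2024, Cor. 5.5 (p. 929)] [cite: MilneADT2006, I §2 Thm 2.8 (p. 31)] -/
theorem exists_ne_zero_mem_selmerGroup_three_of_dictionaryOne_of_levelOne_certificate_of_baseRigidity_epc
    [W.IsGloballyMinimal] [Finite (geomTorsion W ((3 : ℕ) : ℤ))]
    (h3 : W.HasSurjectiveModNGaloisRep ((3 : ℕ) : ℤ))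
    (τ : absoluteGaloisGroup ℚ) (hτμ : τ ∈ rootsOfUnityFixer ℚ 3)
    (hτq : Nonempty (cokerSubOne (W.torsionGaloisModule ((3 : ℕ) : ℤ)) τ ≃+ ZMod 3))
    (inv : LocalInvariants ℚ 3) (hperf : inv.IsPerfect) (hsum : inv.SumLocalTermEqZero)
    (hcompl : inv.SelmerComplement)
    (S : Finset (Place ℚ)) (hS : ∀ w : InfinitePlace ℚ, (Sum.inl w : Place ℚ) ∈ S)
    (h3S : ∀ v : HeightOneSpectrum (𝓞 ℚ), ((3 : ℕ) : 𝓞 ℚ) ∈ v.asIdeal → (Sum.inr v : Place ℚ) ∈ S)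
    (hbadS : ∀ v : HeightOneSpectrum (𝓞 ℚ), ¬ W.HasGoodReductionAt v → (Sum.inr v : Place ℚ) ∈ S)
    (D : KolyvaginDatum (W.torsionGaloisModule ((3 : ℕ) : ℤ)))
    (η : (q : HeightOneSpectrum (𝓞 ℚ)) → (ZMod (Ideal.absNorm q.asIdeal))ˣ)
    (hP : D.primes = frobeniusClassPrimes (W.torsionGaloisModule ((3 : ℕ) : ℤ))
      {v | (Sum.inr v : Place ℚ) ∈ S} τ 3)
    (hT : D.transverse = cyclotomicTransverse (W.torsionGaloisModule ((3 : ℕ) : ℤ)))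
    (hD : D.HasCanonicalComparison 3 η)
    (v₃ : HeightOneSpectrum (𝓞 ℚ)) (hv₃ : ((3 : ℕ) : 𝓞 ℚ) ∈ v₃.asIdeal)
    (hDict : KatoKuriharaDictionaryThreeOneAt W 0 D v₃)
    (hX : Addv W 3) (hc3 : ¬ 3 ∣ (W.baseChange ℚ_[3]).localTamagawaNumber ℤ_[3])
    (ht : Nat.card {Q : (W.baseChange ℚ_[3]).toAffine.Point // (3 : ℕ) • Q = 0} = 1)
    {N : ℕ} [NeZero N] (P : ModularParametrizationData W N)
    (hManin : ¬ ((3 : ℕ) : ℤ) ∣ P.maninConstant)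
    (hΩ : ∃ u : ℚ, ‖(u : ℚ_[3])‖ = 1 ∧ W.realPeriodRat = u * plusPeriod P.f)
    (hzero : ratModP 3 (ratPlusSymbol P.f 0) = 0)
    (n : Finset (HeightOneSpectrum (𝓞 ℚ))) (hn : D.IsLevel n)
    {ψ₀ : (ℓ : ℕ) → (ZMod ℓ)ˣ →* Multiplicative (ZMod 3)}
    (hψ₀ : ∀ q ∈ n, Function.Surjective (ψ₀ (Ideal.absNorm q.asIdeal)))
    (hcert : haveI : NeZero (∏ q ∈ n, Ideal.absNorm q.asIdeal) :=
        ⟨Finset.prod_ne_zero_iff.2 fun q _ => Assembly.absNorm_ne_zero q⟩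
      kuriharaNumber P.f 3 (∏ q ∈ n, Ideal.absNorm q.asIdeal) ψ₀ ≠ 0) :
    ∃ x ∈ (W.kummerSelmerStructure ((3 : ℕ) : ℤ)).selmerGroup, x ≠ 0 :=
  exists_ne_zero_mem_selmerGroup_three_of_dictionaryOne_of_levelOne_certificate_of_baseRigidity W h3 τ
    hτμ hτq inv hperf hsum hcompl (EP.forall_localEulerPoincareCharacteristic_adicCompletion ℚ) S hS
    h3S hbadS D η hP hT hD v₃ hv₃ hDict hX hc3 ht P hManin hΩ hzero n hn hψ₀ hcert

/-- **END-m1 in `W.selmerGroup (3 : ℤ)` currency, [S24]-FREE and `hEP`-FREE: `#Sel^{(3)}(E/ℚ) ≠ 1`**: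
`natCard_selmerGroup_three_ne_one_of_dictionaryOne_of_levelOne_certificate_of_baseRigidity` with the
binder `hEP` DELETED — hEP discharged by p300886 (`EPCTate.localEulerPoincareCharacteristic`, via
`EP.forall_localEulerPoincareCharacteristic_adicCompletion ℚ`); every other binder unchanged and in the
same order (the record side's hypothesis shape).  Debt reduction, not coverage; nothing booked.
[cite: Kim2022StructureSelmer, Thm. 3.13] [cite: Rubin2011, Thm. 2.8.4 and Cor. 2.8.9 (pp. 25–26)]
[cite: MilneADT2006, I §2 Thm 2.8 (p. 31)] -/
theorem natCard_selmerGroup_three_ne_one_of_dictionaryOne_of_levelOne_certificate_of_baseRigidity_epc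
    [W.IsGloballyMinimal] [Finite (geomTorsion W ((3 : ℕ) : ℤ))]
    (h3 : W.HasSurjectiveModNGaloisRep ((3 : ℕ) : ℤ))
    (τ : absoluteGaloisGroup ℚ) (hτμ : τ ∈ rootsOfUnityFixer ℚ 3)
    (hτq : Nonempty (cokerSubOne (W.torsionGaloisModule ((3 : ℕ) : ℤ)) τ ≃+ ZMod 3))
    (inv : LocalInvariants ℚ 3) (hperf : inv.IsPerfect) (hsum : inv.SumLocalTermEqZero)
    (hcompl : inv.SelmerComplement)
    (S : Finset (Place ℚ)) (hS : ∀ w : InfinitePlace ℚ, (Sum.inl w : Place ℚ) ∈ S)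
    (h3S : ∀ v : HeightOneSpectrum (𝓞 ℚ), ((3 : ℕ) : 𝓞 ℚ) ∈ v.asIdeal → (Sum.inr v : Place ℚ) ∈ S)
    (hbadS : ∀ v : HeightOneSpectrum (𝓞 ℚ), ¬ W.HasGoodReductionAt v → (Sum.inr v : Place ℚ) ∈ S)
    (D : KolyvaginDatum (W.torsionGaloisModule ((3 : ℕ) : ℤ)))
    (η : (q : HeightOneSpectrum (𝓞 ℚ)) → (ZMod (Ideal.absNorm q.asIdeal))ˣ)
    (hP : D.primes = frobeniusClassPrimes (W.torsionGaloisModule ((3 : ℕ) : ℤ))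
      {v | (Sum.inr v : Place ℚ) ∈ S} τ 3)
    (hT : D.transverse = cyclotomicTransverse (W.torsionGaloisModule ((3 : ℕ) : ℤ)))
    (hD : D.HasCanonicalComparison 3 η)
    (v₃ : HeightOneSpectrum (𝓞 ℚ)) (hv₃ : ((3 : ℕ) : 𝓞 ℚ) ∈ v₃.asIdeal)
    (hDict : KatoKuriharaDictionaryThreeOneAt W 0 D v₃)
    (hX : Addv W 3) (hc3 : ¬ 3 ∣ (W.baseChange ℚ_[3]).localTamagawaNumber ℤ_[3])
    (ht : Nat.card {Q : (W.baseChange ℚ_[3]).toAffine.Point // (3 : ℕ) • Q = 0} = 1)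
    {N : ℕ} [NeZero N] (P : ModularParametrizationData W N)
    (hManin : ¬ ((3 : ℕ) : ℤ) ∣ P.maninConstant)
    (hΩ : ∃ u : ℚ, ‖(u : ℚ_[3])‖ = 1 ∧ W.realPeriodRat = u * plusPeriod P.f)
    (hzero : ratModP 3 (ratPlusSymbol P.f 0) = 0)
    (n : Finset (HeightOneSpectrum (𝓞 ℚ))) (hn : D.IsLevel n)
    {ψ₀ : (ℓ : ℕ) → (ZMod ℓ)ˣ →* Multiplicative (ZMod 3)}
    (hψ₀ : ∀ q ∈ n, Function.Surjective (ψ₀ (Ideal.absNorm q.asIdeal)))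
    (hcert : haveI : NeZero (∏ q ∈ n, Ideal.absNorm q.asIdeal) :=
        ⟨Finset.prod_ne_zero_iff.2 fun q _ => Assembly.absNorm_ne_zero q⟩
      kuriharaNumber P.f 3 (∏ q ∈ n, Ideal.absNorm q.asIdeal) ψ₀ ≠ 0) :
    Nat.card (W.selmerGroup (3 : ℤ)) ≠ 1 :=
  natCard_selmerGroup_three_ne_one_of_dictionaryOne_of_levelOne_certificate_of_baseRigidity W h3 τ hτμ
    hτq inv hperf hsum hcompl (EP.forall_localEulerPoincareCharacteristic_adicCompletion ℚ) S hS h3S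
    hbadS D η hP hT hD v₃ hv₃ hDict hX hc3 ht P hManin hΩ hzero n hn hψ₀ hcert

end Summit.BirchSwinnertonDyer.Rank1Residual.GaloisImage

end
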